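import Summits.ResolutionOfSingularities.ResolutionOfSingularities.Theorems.MarkedTransferCampaignW46UselessProcrastination
import Summits.ResolutionOfSingularities.ResolutionOfSingularities.Theorems.MarkedTransferCampaignW46PlaneProcrastination
import HarnessLib

/-!
# [OURS · L1 W4.6 rung (i-i)] THE TYPED RUNG (i-i): the ∇-centred typed Th. 16.6 procedure terminates on surfaces for every
# notion instance whose résumés never license a useless procrastination (cell res-hironaka, LADDER-RESOLUTION rung L,
# D-0089; campaign s46, prover res-L1-s46-pv-1; host route MarkedTransfer, `--supports stmt-ResolutionOfSingularities-16155`)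

HONEST FRAMING. Nothing here is a statement of H. Hironaka's manuscript (2017-03-23, [Hironaka2017]) and nothing here
asserts that any statement of it holds. Pure logic over the OURS typed procedure (`…TypedProcedure`, res-L1-type-o1:
`Notions`, `Reading`, `Resume`, `RunNabla`, `TerminatesNabla`, DESIGN POINT (VAC)) and the résumé-free rung (i-i)
(`planeNoUselessProcrastinationTerminates_holds`, companion `…UselessProcrastination`). AI-written; weaker than expert
review. No `sorry`; axioms standard.

## What

The typed rung (i-b) (`terminatesNabla_dimLE_two_of_noStrayPoint`, p515754) required the résumés NEVER to isolate a point
of a singular curve (`Resumes.NoStrayPoint`). Rung (i-i) weakens the hypothesis to its sharp form: the résumés may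
isolate points of singular curves, provided some singular curve of `E` is SINGULAR at the isolated point — only USELESS
procrastinations are forbidden (`Resumes.NoUselessPoint N Rd`). Then `TerminatesNabla N Rd (Regime.dimLE 2)` for every
field `K : Type` of characteristic `p` (`terminatesNabla_dimLE_two_of_noUselessPoint_holds`). VACUITY as (VAC):
contentful exactly for the named notion instances of the rung files.

## References

* companions `…UselessProcrastination` (rung (i-i)), `…PlaneProcrastination` (p515754), `…TypedProcedure`.
* H. Hironaka, ms. 2017-03-23, Th. 16.6 p.84 l.4–9, l.29; Th. 16.13 p.87 l.26–28 — scope only, under adjudication,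
  not cited as fact. [Hironaka2017]
-/

noncomputable section

set_option linter.dupNamespace false -- mandated namespace of this single-conjunct summit

open CategoryTheory AlgebraicGeometry TopologicalSpace

namespace Summit.ResolutionOfSingularities.ResolutionOfSingularities.Theorems

namespace CampaignW46

open Literature.AlgebraicGeometry.Resolution
open Literature.AlgebraicGeometry.Hironaka2017.S02Preliminaries
open Literature.AlgebraicGeometry.Hironaka2017.Datum
open Scheme.IdealSheafData

universe u

variable {n : ℕ} {p : ℕ} [Fact p.Prime] {K : Type u} [Field K] [CharP K p]

/-- [OURS · L1 W4.6 rung (i-i)] NOT a statement of the manuscript. **The résumés read by `Rd` NEVER LICENSE A USELESS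
PROCRASTINATION on surfaces**: for every surface state `(A, E)` and every résumé `R` of `E` read by `Rd`, no component
`D` of the terminal plat `∇(E)` (DESIGN POINT (CMP), `IsNablaComponent`) is a useless procrastination for `E` — if `D` is
a point of a singular curve of `E`, some singular curve of `E` is singular there. Weaker than `Resumes.NoStrayPoint`
(p515754). VACUITY as (VAC). [folklore] -/
def Resumes.NoUselessPoint (N : Notions.{u} n) (Rd : Reading p K N) : Prop :=
  ∀ (A : AmbientDatum p K) (E : IdealExponent A.Z) (R : Resume N A E), Rd A E R → Regime.dimLE 2 A E →
    ∀ (D : Closeds A.Z), IsNablaComponent R D → ¬ UselessProcrastination E D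

/-- `NoStrayPoint ⇒ NoUselessPoint`: résumés that never isolate a point of a singular curve never license a useless
procrastination. [folklore] -/
theorem Resumes.noUselessPoint_of_noStrayPoint {N : Notions.{u} n} {Rd : Reading p K N} (h : Resumes.NoStrayPoint N Rd) :
    Resumes.NoUselessPoint N Rd := by
  intro A E R hR hdim D hD hu
  obtain ⟨⟨ξ, η, hDξ, hηS, hne, hsp⟩, -⟩ := hu
  exact hne (h A E R hR hdim D hD ξ hDξ η hηS hsp)

/-- A ∇-centred run of a notion instance whose résumés never license a useless procrastination makes no useless
procrastination (on surface stages). [folklore] -/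
theorem RunNabla.not_uselessProcrastination_of_noUselessPoint {N : Notions.{u} n} {Rd : Reading p K N}
    (hN : Resumes.NoUselessPoint N Rd) (r : RunNabla N Rd) (k : ℕ) (hdim : Regime.dimLE 2 (r.A k) (r.E k)) :
    ¬ UselessProcrastination (r.toRun.toPermissibleRun.E k) (r.toRun.toPermissibleRun.D k) :=
  hN (r.A k) (r.E k) (r.R k) (r.reads k) hdim (r.step k).toStep.D (r.step k).component

/-- **THE TYPED RUNG (i-i).** [OURS · L1 W4.6 rung (i-i)] NOT a statement of the manuscript. If useless procrastination is
the only obstruction on surfaces (`PlaneNoUselessProcrastinationTerminates p K`), then the ∇-CENTRED typed Th. 16.6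
procedure terminates on surfaces (`TerminatesNabla N Rd (Regime.dimLE 2)`) for EVERY notion instance `N` and reading
`Rd` whose résumés never license a useless procrastination. Contains the typed rung (i-b). [folklore] -/
theorem terminatesNabla_dimLE_two_of_noUselessPoint (h : PlaneNoUselessProcrastinationTerminates p K)
    {N : Notions.{u} n} {Rd : Reading p K N} (hN : Resumes.NoUselessPoint N Rd) :
    TerminatesNabla N Rd (Regime.dimLE 2 (p := p) (K := K)) :=
  fun r hr => h r.toRun.toPermissibleRun hr ⟨0, fun k _ => r.not_uselessProcrastination_of_noUselessPoint hN k (hr k)⟩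

/-- [OURS · L1 W4.6 rung (i-i)] NOT a statement of the manuscript. **THE TYPED RUNG (i-i), UNCONDITIONALLY** (every field
`K : Type` of characteristic `p`): `TerminatesNabla N Rd (Regime.dimLE 2)` for every notion instance whose résumés
never license a useless procrastination. [folklore] -/
theorem terminatesNabla_dimLE_two_of_noUselessPoint_holds {K : Type} [Field K] [CharP K p] {N : Notions.{0} n}
    {Rd : Reading p K N} (hN : Resumes.NoUselessPoint N Rd) : TerminatesNabla N Rd (Regime.dimLE 2 (p := p) (K := K)) :=
  terminatesNabla_dimLE_two_of_noUselessPoint (planeNoUselessProcrastinationTerminates_holds p K) hN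

end CampaignW46

end Summit.ResolutionOfSingularities.ResolutionOfSingularities.Theorems

end
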